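import Mathlib
import HarnessLib
import Summits.Ventures.LatticeQCDFlow.Scoring.KishESSBlockStatistics

/-!
# The ESS column WITHOUT a weight ceiling, at EXPONENTIAL confidence: the median over `R` blocks
# of the PRINTED per-block Kish fractions of ONE proposal stream is within a factor `1 ± ρ` of
# `ESS = 1/M₂` with probability `≥ 1 − e^{−R/8}` — the fourth weight moment is the only input

HONEST FRAMING: exact (Metropolis-corrected) sampling algorithms for lattice gauge theory;
figures of merit are autocorrelation/cost numbers at stated couplings and volumes; no
continuum-physics claim.

Venture `LatticeQCDFlow` (cell pub-lqcd), topic `Scoring`; FANOUT row 4 (`s0-u1-b`, rung S0-B: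
two independent codes compared column by column).  A flow code prints, for each batch of `m`
proposals `y_j` with UNNORMALISED importance weights `w̃_j = c·p(y_j)/q(y_j)` (`c = Z` unknown),
the Kish effective-sample-size fraction `K = (Σ_j w̃_j)² / (m Σ_j w̃_j²) ∈ [0, 1]`; its population
counterpart is `ESS = 1/M₂`, `M₂ = ∫ p²/q dμ = E_q w²` (`w = p/q`).  The tree certifies the ESS
column under a weight CEILING `p ≤ Wq` (`Scoring/ModelDrawESSConfidence`: two-sided,
variance-adaptive, `W²` entering linearly; NOT CLAIMED there: unnormalised weights) and row 4's
ceiling-free files (`Scoring/BlockStatisticsCeilingFree`, `…/AllPairsAcceptanceRatioCeilingFree`,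
`…/ReweightingMedianOfBlocks`, `…/SelfNormalisedReweightingCeilingFree`) treat `M₂ = 1/ESS` as an
INPUT and leave 'the ESS column itself (kernel `w²` needs a fourth moment)' NOT CLAIMED.  This
file closes that item: with the FOURTH weight moment `M₄ = ∫ p⁴/q³ dμ = E_q w⁴` finite (stated as
`Integrable`) the block mean weight `W̄_r` and the block mean squared weight `F̄_r` concentrate by
Chebyshev (`Var_q w = M₂ − 1`, `Var_q w² = M₄ − M₂²`; previous file
`Scoring/KishESSBlockStatistics`), the printed Kish fraction is `K_r = W̄_r²/F̄_r` whatever the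
normalisation `c`, the ratio step gives a RELATIVE radius for `K_r/ESS = K_r·M₂`, and row 4's
finite-index median device (`BlockMedian.measureReal_half_far_le`: independent blocks, each bad
with probability `≤ 1/4`) gives the exponential certificate.  The classical median-of-means idea
(Nemirovsky–Yudin 1983; Devroye–Lerasle–Lugosi–Oliveira, Ann. Statist. 44 (2016); Lugosi–Mendelson,
Found. Comput. Math. 19 (2019) §2) and the importance-sampling sample-size literature
(Agapiou–Papaspiliopoulos–Sanz-Alonso–Stuart, Stat. Sci. 32 (2017) Thm 2.1; Chatterjee–Diaconis,
Ann. Appl. Probab. 28 (2018)) are NAMED ONLY — nothing is cited as a fact; NEW WORK of the cell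
(elementary); no definition is introduced (`Scoring.kishESS` of `Scoring/PooledESS` is reused).

## Content (`ν = μ.withDensity q`; `w = p/q`; `M₂ = ∫ p²/q dμ`; `M₄ = ∫ p⁴/q³ dμ`; block `r` =
## draws `rm, …, rm + m − 1`; `K_r = kishESS(block r)/m`; `ρ(u, s) = (u(2 + u) + s)/(1 − s)`)

For weights printed with ANY normalisation `w̃ = c·p/q`, `c > 0`, blocks of `m ≥ 1` draws,
`R·m ≤ n`, `u > 0`, `0 < s < 1`, `8(M₂ − 1) ≤ m u²`, `8(M₄ − M₂²) ≤ m s² M₂²`: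
* **`kishESS_medianOfBlocks_confidence`** — `P(#{r < R : ρ ≤ |K_r·M₂ − 1|} ≥ R/2) ≤ e^{−R/8}`;
* **`kishESS_sampleMedian_confidence`** — ANY sample-median selection `med(ω)` of the `K_r`:
  `P(ρ ≤ |med·M₂ − 1|) ≤ e^{−R/8}`;
* `kishESS_sampleMedian_confidence_abs` — `P(ρ ≤ |med − ESS|) ≤ e^{−R/8}`, `ESS = M₂⁻¹ ≤ 1`;
* **`kishESS_AB_sampleMedian_confidence`** — two codes `q, q′`, same target, each from ITS OWN
  stream on its own probability space, nothing assumed between them: `≤ e^{−R/8} + e^{−R′/8}`;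
* `exp_neg_blocks_le` (`8 log(1/η) ≤ R` ⇒ `e^{−R/8} ≤ η`) and
  `kishESS_sampleMedian_confidence_of_ceiling` (under a ceiling `p ≤ Wq` the fourth moment is
  automatic, `M₄ ≤ W²M₂`: the absolute certificate at level `η` with `8(W²·ESS − 1) ≤ m s²`-type
  input `8(W²M₂ − M₂²) ≤ m s² M₂²`).

Reading (value-free; no number of ours, no sealed value): cut one proposal stream into
`R ≈ 8 log(1/η)` blocks of `m` draws, print the Kish fraction per block, read the median — it is
within a factor `1 ± ρ(u, s)` of the population ESS, `u² ≥ 8(1/ESS − 1)/m`,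
`s² ≥ 8(M₄/M₂² − 1)/m` (the squared coefficient of variation of `w²` under the model), except with
probability `η`; two codes compare their ESS columns by adding radii, with no ceiling and no parity
hypothesis.  NOT CLAIMED: estimating `M₄/M₂²` (an input, like `M₂` in the earlier files); heavy
tails beyond the fourth weight moment; the chain-side (`τ_int`) column; optimal constants; any
number of ours re-scored.
-/

noncomputable section

namespace Summit.Ventures.LatticeQCDFlow.Scoring.KishESSMedian

open MeasureTheory ProbabilityTheory Finset Real Set
open Summit.Ventures.LatticeQCDFlow.Scoring.BlockMedian
open Summit.Ventures.LatticeQCDFlow.Scoring.AllPairsMedian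
open Summit.Ventures.LatticeQCDFlow.Scoring.ReweightingMedian

section Certificate

variable {Ω : Type*} [MeasurableSpace Ω] {P : Measure Ω} [IsProbabilityMeasure P]
variable {X : Type*} [MeasurableSpace X] {μ : Measure X} {p q : X → ℝ} {n m R : ℕ}

/-- **THE ESS COLUMN WITHOUT A CEILING, EXPONENTIAL CONFIDENCE (relative form).**  `n` independent
model draws `y_j` (laws `μ.withDensity q`); `p` measurable, integrable, `∫ p = 1`, with
`p²/q ∈ L¹(μ)` (`M₂ = ∫ p²/q dμ = 1/ESS`) and `p⁴/q³ ∈ L¹(μ)` (`M₄ = ∫ p⁴/q³ dμ`); `q > 0`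
measurable; weights printed with ANY normalisation `w̃ = c·p/q`, `c > 0`; blocks of `m ≥ 1` draws,
`R·m ≤ n`; `u > 0`, `0 < s < 1` with `8(M₂ − 1) ≤ m u²` and `8(M₄ − M₂²) ≤ m s² M₂²`.  With
`K_r = (Σ_j w̃_j)²/(m Σ_j w̃_j²)` the printed Kish fraction of block `r`:
`P( #{r < R : (u(2 + u) + s)/(1 − s) ≤ |K_r·M₂ − 1|} ≥ R/2 ) ≤ exp(−R/8)`. [ours] -/
theorem kishESS_medianOfBlocks_confidence {y : Fin n → Ω → X} (hym : ∀ j, Measurable (y j))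
    (hind : iIndepFun y P) (hpm : Measurable p) (hpi : Integrable p μ) (hp1 : ∫ z, p z ∂μ = 1)
    (hq0 : ∀ z, 0 < q z) (hqm : Measurable q) (hM2i : Integrable (fun z => p z ^ 2 / q z) μ)
    (hM4i : Integrable (fun z => p z ^ 4 / q z ^ 3) μ)
    (hlaw : ∀ j, Measure.map (y j) P = μ.withDensity fun z => ENNReal.ofReal (q z))
    {wt : X → ℝ} {c : ℝ} (hc : 0 < c) (hwt : ∀ z, wt z = c * (p z / q z))
    (hm : 1 ≤ m) (hRm : R * m ≤ n) {u s : ℝ} (hu : 0 < u) (hs : 0 < s) (hs1 : s < 1)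
    (hvu : 8 * ((∫ z, p z ^ 2 / q z ∂μ) - 1) ≤ m * u ^ 2)
    (hvs : 8 * ((∫ z, p z ^ 4 / q z ^ 3 ∂μ) - (∫ z, p z ^ 2 / q z ∂μ) ^ 2)
      ≤ m * s ^ 2 * (∫ z, p z ^ 2 / q z ∂μ) ^ 2) :
    P.real {ω | (R : ℝ) / 2 ≤ #{r ∈ (univ : Finset (Fin R)) | (u * (2 + u) + s) / (1 - s) ≤
        |kishESS (univ : Finset (Fin m))
              (fun j => wt (y ⟨((r : Fin R) : ℕ) * m + j, mul_add_lt hRm r j⟩ ω)) / m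
            * (∫ z, p z ^ 2 / q z ∂μ) - 1|}} ≤ exp (-(R / 8)) := by
  rcases Nat.eq_zero_or_pos R with hR | hR
  · subst hR
    refine measureReal_le_one.trans ?_
    simp
  have hn : 0 < n := by
    have : 0 < R * m := Nat.mul_pos hR (by omega)
    omega
  have hν : IsProbabilityMeasure (μ.withDensity fun z => ENNReal.ofReal (q z)) :=
    isProbabilityMeasure_of_map_eq_iid (hym ⟨0, hn⟩) (hlaw ⟨0, hn⟩)
  set M : ℝ := ∫ z, p z ^ 2 / q z ∂μ with hMdef
  have hM1 : 1 ≤ M := one_le_secondMoment_model hν hpm hpi hp1 hq0 hqm hM2i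
  have hM0 : 0 < M := one_pos.trans_le hM1
  have hwtm : Measurable wt := by
    have : wt = fun z => c * (p z / q z) := funext hwt
    rw [this]
    exact (hpm.div hqm).const_mul c
  have hm0 : (0 : ℝ) < m := by exact_mod_cast hm
  -- the block statistic `K_r·M` as a measurable function of the block; independence across blocks
  have hg : Measurable fun (v : Fin m → X) =>
      kishESS (univ : Finset (Fin m)) (fun j => wt (v j)) / m * M := by
    unfold kishESS
    exact ((((Finset.measurable_sum _ fun (j : Fin m) _ =>
        hwtm.comp (measurable_pi_apply j)).pow_const 2).div
      (Finset.measurable_sum _ fun (j : Fin m) _ =>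
        (hwtm.comp (measurable_pi_apply j)).pow_const 2)).div_const _).mul_const _
  have hYind : iIndepFun (fun (r : Fin R) ω => kishESS (univ : Finset (Fin m))
      (fun j => wt (y ⟨(r : ℕ) * m + j, mul_add_lt hRm r j⟩ ω)) / m * M) P :=
    iIndepFun_blockFun hym hind hRm hg
  have hYm : ∀ r : Fin R, Measurable fun ω => kishESS (univ : Finset (Fin m))
      (fun j => wt (y ⟨(r : ℕ) * m + j, mul_add_lt hRm r j⟩ ω)) / m * M := fun r => by
    have hblk : Measurable fun ω => fun (i : Fin m) => y ⟨(r : ℕ) * m + i, mul_add_lt hRm r i⟩ ω :=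
      measurable_pi_lambda _ fun i => hym _
    exact hg.comp hblk
  -- each block is bad with probability ≤ 1/8 + 1/8
  have hfar : ∀ r ∈ (univ : Finset (Fin R)), P.real {ω | (u * (2 + u) + s) / (1 - s) ≤
      |kishESS (univ : Finset (Fin m))
          (fun j => wt (y ⟨(r : ℕ) * m + j, mul_add_lt hRm r j⟩ ω)) / m * M - 1|} ≤ 1 / 4 := by
    intro r _
    -- Chebyshev for the block mean weight `W̄_r` and the block mean squared weight `F̄_r`
    have hW := meanWeight_chebyshev_iid
      (x := fun (i : Fin m) => y ⟨(r : ℕ) * m + i, mul_add_lt hRm r i⟩) (fun i => hym _)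
      (iIndepFun_block hind hRm r) hpm hpi hp1 hq0 hqm hM2i (fun i => hlaw _) hm hu
    have hF := blockSqWeightMean_chebyshev_iid
      (x := fun (i : Fin m) => y ⟨(r : ℕ) * m + i, mul_add_lt hRm r i⟩) (fun i => hym _)
      (iIndepFun_block hind hRm r) hpm hq0 hqm hM4i (fun i => hlaw _) hm (t := s * M)
      (mul_pos hs hM0)
    have hratio : ∀ ω, kishESS (univ : Finset (Fin m))
          (fun j => wt (y ⟨(r : ℕ) * m + j, mul_add_lt hRm r j⟩ ω)) / m
        = ((∑ j : Fin m, p (y ⟨(r : ℕ) * m + j, mul_add_lt hRm r j⟩ ω)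
              / q (y ⟨(r : ℕ) * m + j, mul_add_lt hRm r j⟩ ω)) / m) ^ 2
          / ((∑ j : Fin m, (p (y ⟨(r : ℕ) * m + j, mul_add_lt hRm r j⟩ ω)
              / q (y ⟨(r : ℕ) * m + j, mul_add_lt hRm r j⟩ ω)) ^ 2) / m) := fun ω => by
      rw [blockKish_scale_free hc.ne' hwt fun i => y ⟨(r : ℕ) * m + i, mul_add_lt hRm r i⟩ ω,
        kishFrac_eq_sq_div]
    have hsub : {ω | (u * (2 + u) + s) / (1 - s) ≤
          |kishESS (univ : Finset (Fin m))
              (fun j => wt (y ⟨(r : ℕ) * m + j, mul_add_lt hRm r j⟩ ω)) / m * M - 1|}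
        ⊆ {ω | u ≤ |(∑ j : Fin m, p (y ⟨(r : ℕ) * m + j, mul_add_lt hRm r j⟩ ω)
              / q (y ⟨(r : ℕ) * m + j, mul_add_lt hRm r j⟩ ω)) / m - 1|}
          ∪ {ω | s * M ≤ |(∑ j : Fin m, (p (y ⟨(r : ℕ) * m + j, mul_add_lt hRm r j⟩ ω)
              / q (y ⟨(r : ℕ) * m + j, mul_add_lt hRm r j⟩ ω)) ^ 2) / m - M|} := by
      intro ω hω
      simp only [Set.mem_setOf_eq, Set.mem_union] at hω ⊢
      rw [hratio ω] at hω
      by_contra hcon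
      simp only [not_or, not_le] at hcon
      obtain ⟨h1, h2⟩ := hcon
      have key := abs_sq_div_mul_sub_one_lt hM0 hu.le hs1 h1 h2
      linarith
    have hW' : ((∫ z, p z ^ 2 / q z ∂μ) - 1) / (m * u ^ 2) ≤ 1 / 8 := by
      rw [div_le_iff₀ (by positivity)]
      linarith
    have hF' : ((∫ z, p z ^ 4 / q z ^ 3 ∂μ) - (∫ z, p z ^ 2 / q z ∂μ) ^ 2)
        / (m * (s * M) ^ 2) ≤ 1 / 8 := by
      rw [div_le_iff₀ (by positivity)]
      have e : (m : ℝ) * (s * M) ^ 2 = m * s ^ 2 * M ^ 2 := by ring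
      rw [e]
      linarith
    calc P.real _ ≤ P.real _ := measureReal_mono hsub
      _ ≤ _ := measureReal_union_le _ _
      _ ≤ 1 / 8 + 1 / 8 := add_le_add (hW.trans hW') (hF.trans hF')
      _ = 1 / 4 := by norm_num
  have h := measureReal_half_far_le (μ := P) (univ : Finset (Fin R)) hYind hYm 1
    ((u * (2 + u) + s) / (1 - s)) hfar
  simpa only [card_univ, Fintype.card_fin] using h

/-- **THE ESS COLUMN WITHOUT A CEILING, FOR ANY SAMPLE MEDIAN** `med(ω)` of the `R` printed block
Kish fractions `K_0(ω), …, K_{R−1}(ω)` (at least half `≥ med ω`, at least half `≤ med ω`; no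
measurability needed): under the hypotheses of `kishESS_medianOfBlocks_confidence`,
`P( (u(2 + u) + s)/(1 − s) ≤ |med·M₂ − 1| ) ≤ exp(−R/8)` — the median is within a factor
`1 ± ρ(u, s)` of `ESS = 1/M₂`. [ours] -/
theorem kishESS_sampleMedian_confidence {y : Fin n → Ω → X} (hym : ∀ j, Measurable (y j))
    (hind : iIndepFun y P) (hpm : Measurable p) (hpi : Integrable p μ) (hp1 : ∫ z, p z ∂μ = 1)
    (hq0 : ∀ z, 0 < q z) (hqm : Measurable q) (hM2i : Integrable (fun z => p z ^ 2 / q z) μ)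
    (hM4i : Integrable (fun z => p z ^ 4 / q z ^ 3) μ)
    (hlaw : ∀ j, Measure.map (y j) P = μ.withDensity fun z => ENNReal.ofReal (q z))
    {wt : X → ℝ} {c : ℝ} (hc : 0 < c) (hwt : ∀ z, wt z = c * (p z / q z))
    (hm : 1 ≤ m) (hRm : R * m ≤ n) {u s : ℝ} (hu : 0 < u) (hs : 0 < s) (hs1 : s < 1)
    (hvu : 8 * ((∫ z, p z ^ 2 / q z ∂μ) - 1) ≤ m * u ^ 2)
    (hvs : 8 * ((∫ z, p z ^ 4 / q z ^ 3 ∂μ) - (∫ z, p z ^ 2 / q z ∂μ) ^ 2)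
      ≤ m * s ^ 2 * (∫ z, p z ^ 2 / q z ∂μ) ^ 2) {med : Ω → ℝ}
    (hlo : ∀ ω, (R : ℝ) / 2 ≤ #{r ∈ (univ : Finset (Fin R)) | med ω ≤
        kishESS (univ : Finset (Fin m))
          (fun j => wt (y ⟨((r : Fin R) : ℕ) * m + j, mul_add_lt hRm r j⟩ ω)) / m})
    (hhi : ∀ ω, (R : ℝ) / 2 ≤ #{r ∈ (univ : Finset (Fin R)) |
        kishESS (univ : Finset (Fin m))
          (fun j => wt (y ⟨((r : Fin R) : ℕ) * m + j, mul_add_lt hRm r j⟩ ω)) / m ≤ med ω}) :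
    P.real {ω | (u * (2 + u) + s) / (1 - s) ≤ |med ω * (∫ z, p z ^ 2 / q z ∂μ) - 1|}
      ≤ exp (-(R / 8)) := by
  rcases Nat.eq_zero_or_pos R with hR | hR
  · subst hR
    refine measureReal_le_one.trans ?_
    simp
  have hn : 0 < n := by
    have : 0 < R * m := Nat.mul_pos hR (by omega)
    omega
  have hν : IsProbabilityMeasure (μ.withDensity fun z => ENNReal.ofReal (q z)) :=
    isProbabilityMeasure_of_map_eq_iid (hym ⟨0, hn⟩) (hlaw ⟨0, hn⟩)
  have hM0 : 0 < ∫ z, p z ^ 2 / q z ∂μ :=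
    one_pos.trans_le (one_le_secondMoment_model hν hpm hpi hp1 hq0 hqm hM2i)
  refine (measureReal_mono ?_).trans
    (kishESS_medianOfBlocks_confidence hym hind hpm hpi hp1 hq0 hqm hM2i hM4i hlaw hc hwt hm hRm
      hu hs hs1 hvu hvs)
  intro ω hω
  simp only [Set.mem_setOf_eq] at hω ⊢
  by_contra hlt
  push Not at hlt
  have hR' : (#(univ : Finset (Fin R)) : ℝ) = R := by rw [card_univ, Fintype.card_fin]
  -- the selection conditions transported to the rescaled statistics `K_r·M₂` (`M₂ > 0`)
  have hlo' : (#(univ : Finset (Fin R)) : ℝ) / 2 ≤ #{r ∈ (univ : Finset (Fin R)) |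
      med ω * (∫ z, p z ^ 2 / q z ∂μ) ≤ kishESS (univ : Finset (Fin m))
        (fun j => wt (y ⟨((r : Fin R) : ℕ) * m + j, mul_add_lt hRm r j⟩ ω)) / m
          * (∫ z, p z ^ 2 / q z ∂μ)} := by
    rw [hR']
    refine (hlo ω).trans (le_of_eq ?_)
    congr 2
    ext r
    simp only [Finset.mem_filter, Finset.mem_univ, true_and]
    exact (mul_le_mul_iff_of_pos_right hM0).symm
  have hhi' : (#(univ : Finset (Fin R)) : ℝ) / 2 ≤ #{r ∈ (univ : Finset (Fin R)) |
      kishESS (univ : Finset (Fin m))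
        (fun j => wt (y ⟨((r : Fin R) : ℕ) * m + j, mul_add_lt hRm r j⟩ ω)) / m
          * (∫ z, p z ^ 2 / q z ∂μ) ≤ med ω * (∫ z, p z ^ 2 / q z ∂μ)} := by
    rw [hR']
    refine (hhi ω).trans (le_of_eq ?_)
    congr 2
    ext r
    simp only [Finset.mem_filter, Finset.mem_univ, true_and]
    exact (mul_le_mul_iff_of_pos_right hM0).symm
  have h := abs_median_sub_lt_of_card_lt (univ : Finset (Fin R)) _ hlo' hhi' (hR' ▸ hlt)
  linarith

/-- **THE ESS COLUMN WITHOUT A CEILING, absolute form**: under the same hypotheses, for any sample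
median `med(ω)` of the printed block Kish fractions, `P( (u(2 + u) + s)/(1 − s) ≤ |med − ESS| )
≤ exp(−R/8)` with `ESS = (∫ p²/q dμ)⁻¹` (`ESS ≤ 1`, so the absolute error is at most the relative
one). [ours] -/
theorem kishESS_sampleMedian_confidence_abs {y : Fin n → Ω → X} (hym : ∀ j, Measurable (y j))
    (hind : iIndepFun y P) (hpm : Measurable p) (hpi : Integrable p μ) (hp1 : ∫ z, p z ∂μ = 1)
    (hq0 : ∀ z, 0 < q z) (hqm : Measurable q) (hM2i : Integrable (fun z => p z ^ 2 / q z) μ)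
    (hM4i : Integrable (fun z => p z ^ 4 / q z ^ 3) μ)
    (hlaw : ∀ j, Measure.map (y j) P = μ.withDensity fun z => ENNReal.ofReal (q z))
    {wt : X → ℝ} {c : ℝ} (hc : 0 < c) (hwt : ∀ z, wt z = c * (p z / q z))
    (hm : 1 ≤ m) (hRm : R * m ≤ n) {u s : ℝ} (hu : 0 < u) (hs : 0 < s) (hs1 : s < 1)
    (hvu : 8 * ((∫ z, p z ^ 2 / q z ∂μ) - 1) ≤ m * u ^ 2)
    (hvs : 8 * ((∫ z, p z ^ 4 / q z ^ 3 ∂μ) - (∫ z, p z ^ 2 / q z ∂μ) ^ 2)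
      ≤ m * s ^ 2 * (∫ z, p z ^ 2 / q z ∂μ) ^ 2) {med : Ω → ℝ}
    (hlo : ∀ ω, (R : ℝ) / 2 ≤ #{r ∈ (univ : Finset (Fin R)) | med ω ≤
        kishESS (univ : Finset (Fin m))
          (fun j => wt (y ⟨((r : Fin R) : ℕ) * m + j, mul_add_lt hRm r j⟩ ω)) / m})
    (hhi : ∀ ω, (R : ℝ) / 2 ≤ #{r ∈ (univ : Finset (Fin R)) |
        kishESS (univ : Finset (Fin m))
          (fun j => wt (y ⟨((r : Fin R) : ℕ) * m + j, mul_add_lt hRm r j⟩ ω)) / m ≤ med ω}) :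
    P.real {ω | (u * (2 + u) + s) / (1 - s) ≤ |med ω - (∫ z, p z ^ 2 / q z ∂μ)⁻¹|}
      ≤ exp (-(R / 8)) := by
  rcases Nat.eq_zero_or_pos R with hR | hR
  · subst hR
    refine measureReal_le_one.trans ?_
    simp
  have hn : 0 < n := by
    have : 0 < R * m := Nat.mul_pos hR (by omega)
    omega
  have hν : IsProbabilityMeasure (μ.withDensity fun z => ENNReal.ofReal (q z)) :=
    isProbabilityMeasure_of_map_eq_iid (hym ⟨0, hn⟩) (hlaw ⟨0, hn⟩)
  have hM1 : 1 ≤ ∫ z, p z ^ 2 / q z ∂μ := one_le_secondMoment_model hν hpm hpi hp1 hq0 hqm hM2i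
  refine (measureReal_mono ?_).trans
    (kishESS_sampleMedian_confidence hym hind hpm hpi hp1 hq0 hqm hM2i hM4i hlaw hc hwt hm hRm
      hu hs hs1 hvu hvs hlo hhi)
  intro ω hω
  simp only [Set.mem_setOf_eq] at hω ⊢
  exact hω.trans (abs_sub_inv_le_of_one_le hM1)

/-- **A versus B for the ESS column, no ceiling, no parity hypothesis.**  Two codes with model
densities `q, q′` (each `> 0`, measurable) and the same target `p` (`p²/q, p⁴/q³, p²/q′, p⁴/q′³`
integrable), each certified from ITS OWN stream (`n` draws in `R` blocks of `m` on `(Ω, P)`, resp.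
`n′` draws in `R′` blocks of `m′` on `(Ω′, P′)`) with its own printed normalisation and radii
`ρ = (u(2 + u) + s)/(1 − s)`, `ρ′` as above: the two bad events have total probability
`≤ exp(−R/8) + exp(−R′/8)`; outside them the two medians are within `ρ`, `ρ′` of `ESS(p, q)`,
`ESS(p, q′)`, so their difference estimates `ESS − ESS′` to `±(ρ + ρ′)`. [ours] -/
theorem kishESS_AB_sampleMedian_confidence {n' m' R' : ℕ} {Ω' : Type*} [MeasurableSpace Ω']
    {P' : Measure Ω'} [IsProbabilityMeasure P'] {y : Fin n → Ω → X} {y' : Fin n' → Ω' → X}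
    (hym : ∀ j, Measurable (y j)) (hind : iIndepFun y P) (hym' : ∀ j, Measurable (y' j))
    (hind' : iIndepFun y' P') {q' : X → ℝ} (hpm : Measurable p) (hpi : Integrable p μ)
    (hp1 : ∫ z, p z ∂μ = 1) (hq0 : ∀ z, 0 < q z) (hqm : Measurable q)
    (hM2i : Integrable (fun z => p z ^ 2 / q z) μ)
    (hM4i : Integrable (fun z => p z ^ 4 / q z ^ 3) μ) (hq0' : ∀ z, 0 < q' z)
    (hqm' : Measurable q') (hM2i' : Integrable (fun z => p z ^ 2 / q' z) μ)
    (hM4i' : Integrable (fun z => p z ^ 4 / q' z ^ 3) μ)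
    (hlaw : ∀ j, Measure.map (y j) P = μ.withDensity fun z => ENNReal.ofReal (q z))
    (hlaw' : ∀ j, Measure.map (y' j) P' = μ.withDensity fun z => ENNReal.ofReal (q' z))
    {wt wt' : X → ℝ} {c c' : ℝ} (hc : 0 < c) (hwt : ∀ z, wt z = c * (p z / q z)) (hc' : 0 < c')
    (hwt' : ∀ z, wt' z = c' * (p z / q' z))
    (hm : 1 ≤ m) (hRm : R * m ≤ n) (hm' : 1 ≤ m') (hRm' : R' * m' ≤ n') {u s u' s' : ℝ}
    (hu : 0 < u) (hs : 0 < s) (hs1 : s < 1) (hu' : 0 < u') (hs' : 0 < s') (hs1' : s' < 1)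
    (hvu : 8 * ((∫ z, p z ^ 2 / q z ∂μ) - 1) ≤ m * u ^ 2)
    (hvs : 8 * ((∫ z, p z ^ 4 / q z ^ 3 ∂μ) - (∫ z, p z ^ 2 / q z ∂μ) ^ 2)
      ≤ m * s ^ 2 * (∫ z, p z ^ 2 / q z ∂μ) ^ 2)
    (hvu' : 8 * ((∫ z, p z ^ 2 / q' z ∂μ) - 1) ≤ m' * u' ^ 2)
    (hvs' : 8 * ((∫ z, p z ^ 4 / q' z ^ 3 ∂μ) - (∫ z, p z ^ 2 / q' z ∂μ) ^ 2)
      ≤ m' * s' ^ 2 * (∫ z, p z ^ 2 / q' z ∂μ) ^ 2)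
    {med : Ω → ℝ} {med' : Ω' → ℝ}
    (hlo : ∀ ω, (R : ℝ) / 2 ≤ #{r ∈ (univ : Finset (Fin R)) | med ω ≤
        kishESS (univ : Finset (Fin m))
          (fun j => wt (y ⟨((r : Fin R) : ℕ) * m + j, mul_add_lt hRm r j⟩ ω)) / m})
    (hhi : ∀ ω, (R : ℝ) / 2 ≤ #{r ∈ (univ : Finset (Fin R)) |
        kishESS (univ : Finset (Fin m))
          (fun j => wt (y ⟨((r : Fin R) : ℕ) * m + j, mul_add_lt hRm r j⟩ ω)) / m ≤ med ω})
    (hlo' : ∀ ω, (R' : ℝ) / 2 ≤ #{r ∈ (univ : Finset (Fin R')) | med' ω ≤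
        kishESS (univ : Finset (Fin m'))
          (fun j => wt' (y' ⟨((r : Fin R') : ℕ) * m' + j, mul_add_lt hRm' r j⟩ ω)) / m'})
    (hhi' : ∀ ω, (R' : ℝ) / 2 ≤ #{r ∈ (univ : Finset (Fin R')) |
        kishESS (univ : Finset (Fin m'))
          (fun j => wt' (y' ⟨((r : Fin R') : ℕ) * m' + j, mul_add_lt hRm' r j⟩ ω)) / m'
            ≤ med' ω}) :
    P.real {ω | (u * (2 + u) + s) / (1 - s) ≤ |med ω - (∫ z, p z ^ 2 / q z ∂μ)⁻¹|}
      + P'.real {ω | (u' * (2 + u') + s') / (1 - s') ≤ |med' ω - (∫ z, p z ^ 2 / q' z ∂μ)⁻¹|}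
      ≤ exp (-(R / 8)) + exp (-(R' / 8)) :=
  add_le_add
    (kishESS_sampleMedian_confidence_abs hym hind hpm hpi hp1 hq0 hqm hM2i hM4i hlaw hc hwt hm hRm
      hu hs hs1 hvu hvs hlo hhi)
    (kishESS_sampleMedian_confidence_abs hym' hind' hpm hpi hp1 hq0' hqm' hM2i' hM4i' hlaw' hc'
      hwt' hm' hRm' hu' hs' hs1' hvu' hvs' hlo' hhi')

/-- **Block count for a prescribed confidence**: `0 < η` and `8·log(1/η) ≤ R` give
`exp(−R/8) ≤ η` (so `R = ⌈8 log(1/η)⌉` blocks suffice in every certificate of this file). [ours] -/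
theorem exp_neg_blocks_le {η : ℝ} (hη : 0 < η) (hR : 8 * Real.log (1 / η) ≤ R) :
    exp (-((R : ℝ) / 8)) ≤ η := by
  have h : -((R : ℝ) / 8) ≤ Real.log η := by
    rw [one_div, Real.log_inv] at hR
    linarith
  calc exp (-((R : ℝ) / 8)) ≤ exp (Real.log η) := exp_le_exp.2 h
    _ = η := Real.exp_log hη

/-- **THE ESS COLUMN UNDER A WEIGHT CEILING, via the median of blocks.**  With `0 ≤ p ≤ Wq` the
fourth-moment hypothesis is automatic (`M₄ ≤ W²M₂`, `KishESSMedian.fourthMoment_le_of_ceiling`),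
so the absolute certificate holds with the variance condition checked as
`8(W²M₂ − M₂²) ≤ m s² M₂²`, i.e. `8(W²·ESS − 1) ≤ m s²`; and with `8 log(1/η) ≤ R` blocks the
failure probability is `≤ η`. [ours] -/
theorem kishESS_sampleMedian_confidence_of_ceiling {y : Fin n → Ω → X}
    (hym : ∀ j, Measurable (y j)) (hind : iIndepFun y P) (hp0 : ∀ z, 0 ≤ p z)
    (hpm : Measurable p) (hpi : Integrable p μ) (hp1 : ∫ z, p z ∂μ = 1) (hq0 : ∀ z, 0 < q z)
    (hqm : Measurable q) (hM2i : Integrable (fun z => p z ^ 2 / q z) μ) {W : ℝ}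
    (hW : ∀ z, p z ≤ W * q z)
    (hlaw : ∀ j, Measure.map (y j) P = μ.withDensity fun z => ENNReal.ofReal (q z))
    {wt : X → ℝ} {c : ℝ} (hc : 0 < c) (hwt : ∀ z, wt z = c * (p z / q z))
    (hm : 1 ≤ m) (hRm : R * m ≤ n) {u s η : ℝ} (hu : 0 < u) (hs : 0 < s) (hs1 : s < 1)
    (hvu : 8 * ((∫ z, p z ^ 2 / q z ∂μ) - 1) ≤ m * u ^ 2)
    (hvs : 8 * (W ^ 2 * (∫ z, p z ^ 2 / q z ∂μ) - (∫ z, p z ^ 2 / q z ∂μ) ^ 2)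
      ≤ m * s ^ 2 * (∫ z, p z ^ 2 / q z ∂μ) ^ 2)
    (hη : 0 < η) (hR : 8 * Real.log (1 / η) ≤ R) {med : Ω → ℝ}
    (hlo : ∀ ω, (R : ℝ) / 2 ≤ #{r ∈ (univ : Finset (Fin R)) | med ω ≤
        kishESS (univ : Finset (Fin m))
          (fun j => wt (y ⟨((r : Fin R) : ℕ) * m + j, mul_add_lt hRm r j⟩ ω)) / m})
    (hhi : ∀ ω, (R : ℝ) / 2 ≤ #{r ∈ (univ : Finset (Fin R)) |
        kishESS (univ : Finset (Fin m))
          (fun j => wt (y ⟨((r : Fin R) : ℕ) * m + j, mul_add_lt hRm r j⟩ ω)) / m ≤ med ω}) :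
    P.real {ω | (u * (2 + u) + s) / (1 - s) ≤ |med ω - (∫ z, p z ^ 2 / q z ∂μ)⁻¹|} ≤ η := by
  obtain ⟨hM4i, hM4le⟩ := fourthMoment_le_of_ceiling (μ := μ) hp0 hpm hq0 hqm hM2i hW
  refine (kishESS_sampleMedian_confidence_abs hym hind hpm hpi hp1 hq0 hqm hM2i hM4i hlaw hc hwt
    hm hRm hu hs hs1 hvu (by linarith) hlo hhi).trans (exp_neg_blocks_le hη hR)

end Certificate

end Summit.Ventures.LatticeQCDFlow.Scoring.KishESSMedian

end
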